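import Summits.ValiantsHypothesis.ValiantsHypothesis.Theorems.NcUniqueParseTreePermanent
import HarnessLib

/-!
# Rotation-UPT non-commutative circuits: the structure theorem over all frames

Restricted-models rung of the `CommutativityDial` ladder (item `PerNotNcVP` untouched). MODEL:
rotUPT = rotation-UPT NORMAL FORM: circuits typed by a shape T in which every product gate
multiplies an operand typed by its left child and one typed by its right child IN EITHER ORDER
(GateRot = LLS18 Prop 7 typing + the rotated product); the conversion of an arbitrary rotUPT
circuit (LLS18 §4: all parse trees rotations of one tree) to this normal form (gate duplication
per node, poly blow-up) is NOT formalised (LLS18 = Lagarde–Limaye–Srinivasan 2018, Thm 17). The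
class contains the UPT-NF rung's class IN KERNEL (`GateRot.of_gateTyped`) and the comb-typed
circuits; sits above the SKEW rung (IsFanInTwo ∧ IsSkew) ON PAPER ONLY (LLS18 §1; conversion not
formalised). `frames T π`: the pairs (letters left of the block of node `π`, letters right of
it) over all `2^depth` rotations. `output_mem_rotSpan`: for a node `π₀` with ≥ 2 leaves the
output is an `R`-combination of `h · g · h̄`, `g` a value of a gate typed `π₀`, `(deg h, deg h̄)
∈ frames T π₀` (the UPT theorem `output_mem_uptSpan` is the one-frame case, `uptSpan_le_rotSpan`).
-/

noncomputable section

namespace Summit.ValiantsHypothesis.ValiantsHypothesis.Theorems.NcRotParseTree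

set_option linter.dupNamespace false

open Literature.Computability.AlgebraicComplexity
  Literature.Computability.AlgebraicComplexity.ArithCircuit
  Summit.ValiantsHypothesis.ValiantsHypothesis.Theorems.NcAutomatonIntersection
  Summit.ValiantsHypothesis.ValiantsHypothesis.Theorems.NcCentralWidth
  Summit.ValiantsHypothesis.ValiantsHypothesis.Theorems.NcPalindromePower
  Summit.ValiantsHypothesis.ValiantsHypothesis.Theorems.NcUniqueParseTree

/-- FRAMES of node `π` of `S`: all (letters left of its block, letters right of it) over all
rotations — each ancestor puts the sibling on either side. [cite: LagardeLimayeSrinivasan2018] -/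
def frames : Shape → List Bool → Finset (ℕ × ℕ)
  | _, [] => {(0, 0)}
  | .leaf, _ :: _ => ∅
  | .node l r, false :: τ =>
      (frames l τ).image (fun p => (p.1, p.2 + r.size)) ∪
        (frames l τ).image (fun p => (p.1 + r.size, p.2))
  | .node l r, true :: τ =>
      (frames r τ).image (fun p => (p.1 + l.size, p.2)) ∪
        (frames r τ).image (fun p => (p.1, p.2 + l.size))

/-- [cite: LagardeLimayeSrinivasan2018, §4 Theorem 17] -/
theorem frames_nil (S : Shape) : frames S [] = {(0, 0)} := by cases S <;> rfl

/-- Frames of node `π` have total context `|T| - |S|`. [cite: LagardeLimayeSrinivasan2018, §4] -/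
theorem frames_total {T : Shape} {π : List Bool} {S : Shape} (hS : T.sub π = some S)
    {p : ℕ × ℕ} (hp : p ∈ frames T π) : p.1 + S.size + p.2 = T.size := by
  induction π generalizing T p with
  | nil =>
    rw [Shape.sub_nil, Option.some.injEq] at hS; subst hS
    rw [frames_nil, Finset.mem_singleton] at hp; subst hp; simp
  | cons c π ih =>
    cases T with
    | leaf => exact absurd hS (by simp [Shape.sub])
    | node l r =>
      cases c <;> simp only [Shape.sub] at hS <;>
        simp only [frames, Finset.mem_union, Finset.mem_image] at hp <;>
        rcases hp with ⟨q, hq, rfl⟩ | ⟨q, hq, rfl⟩ <;> have h := ih hS hq <;>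
        simp only [Shape.size] <;> omega

/-- DICHOTOMY for a child `π' · c` of node `π'` (sub-shape `S'`): in every frame of the child the
left or the right context is at most `|T| - |S'|`. [cite: LagardeLimayeSrinivasan2018, Thm 17] -/
theorem frames_snoc {T : Shape} {π' : List Bool} {S' : Shape} (hS' : T.sub π' = some S')
    (c : Bool) {p : ℕ × ℕ} (hp : p ∈ frames T (π' ++ [c])) :
    p.1 + S'.size ≤ T.size ∨ p.2 + S'.size ≤ T.size := by
  induction π' generalizing T p with
  | nil =>
    rw [Shape.sub_nil, Option.some.injEq] at hS'; subst hS'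
    rw [List.nil_append] at hp
    cases T with
    | leaf => simp [frames] at hp
    | node l r =>
      cases c <;> simp only [frames, Finset.mem_union, Finset.mem_image] at hp <;>
        rcases hp with ⟨q, hq, rfl⟩ | ⟨q, hq, rfl⟩ <;>
        rw [Finset.mem_singleton] at hq <;> subst hq <;> simp only [Shape.size] <;> omega
  | cons c₀ π' ih =>
    cases T with
    | leaf => exact absurd hS' (by simp [Shape.sub])
    | node l r =>
      cases c₀ <;> simp only [Shape.sub] at hS' <;>
        simp only [List.cons_append, frames, Finset.mem_union, Finset.mem_image] at hp <;>
        rcases hp with ⟨q, hq, rfl⟩ | ⟨q, hq, rfl⟩ <;> have h := ih hS' hq <;>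
        simp only [Shape.size] <;> omega

section Typed
variable {R : Type*} [CommSemiring R] {σ : Type*}

/-- A gate *rot-typed `π`*: a sum / copy of operands typed `π`, or (internal `π`) the product of
an operand typed `π·0` by one typed `π·1` IN EITHER ORDER. [cite: LagardeLimayeSrinivasan2018] -/
inductive GateRot (T : Shape) (ty : ℕ → List Bool) (π : List Bool) : Gate R σ → Prop
  | sum {args : List (R × Operand R σ)} (h : ∀ a ∈ args, OpTyped T ty π a.2) :
      GateRot T ty π (.sum args)
  | copy {u : Operand R σ} (h : OpTyped T ty π u) : GateRot T ty π (.prod [u])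
  | mul {u u' : Operand R σ} {l r : Shape} (hπ : T.sub π = some (.node l r))
      (hu : OpTyped T ty (π ++ [false]) u) (hu' : OpTyped T ty (π ++ [true]) u') :
      GateRot T ty π (.prod [u, u'])
  | rot {u u' : Operand R σ} {l r : Shape} (hπ : T.sub π = some (.node l r))
      (hu : OpTyped T ty (π ++ [true]) u) (hu' : OpTyped T ty (π ++ [false]) u') :
      GateRot T ty π (.prod [u, u'])

/-- UPT normal form ⊆ rotation-UPT normal form. [cite: LagardeLimayeSrinivasan2018, §4] -/
theorem GateRot.of_gateTyped {T : Shape} {ty : ℕ → List Bool} {π : List Bool} {g : Gate R σ}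
    (hg : GateTyped T ty π g) : GateRot T ty π g := by
  cases hg with
  | sum h => exact .sum h | copy h => exact .copy h | mul hπ hu hu' => exact .mul hπ hu hu'

/-- **Non-vacuity, strictness**: `g₀ = x·y` (type `0`), `g₁ = g₀·z`, `g₂ = z·g₀` (rotated),
`g₃ = g₁ + g₂` (= `xyz + zxy`, shape `node (node leaf leaf) leaf`, parse trees = both combs) is
rot-typed and its rotated gate is NOT `GateTyped`. [cite: LagardeLimayeSrinivasan2018, §4] -/
theorem rot_inhabited (x y z : σ) :
    let gs : List (Gate R σ) := [Gate.prod [Operand.var x, Operand.var y],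
      Gate.prod [Operand.gate 0, Operand.var z], Gate.prod [Operand.var z, Operand.gate 0],
      Gate.sum [(1, Operand.gate 1), (1, Operand.gate 2)]]
    let T : Shape := .node (.node .leaf .leaf) .leaf
    let ty : ℕ → List Bool := fun i => if i = 0 then [false] else []
    (∀ i (hi : i < gs.length), GateRot T ty (ty i) gs[i]) ∧
      OpTyped T ty [] (Operand.gate 3 : Operand R σ) ∧
      ¬ GateTyped T ty [] (Gate.prod [Operand.var z, (Operand.gate 0 : Operand R σ)]) := by
  dsimp only
  refine ⟨fun i hi => ?_, OpTyped.gate rfl, fun h => ?_⟩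
  · have hi4 : i < 4 := by simpa using hi
    interval_cases i
    · exact GateRot.mul (l := .leaf) (r := .leaf) rfl (OpTyped.var rfl) (OpTyped.var rfl)
    · exact .mul (l := .node .leaf .leaf) (r := .leaf) rfl (OpTyped.gate rfl) (OpTyped.var rfl)
    · exact .rot (l := .node .leaf .leaf) (r := .leaf) rfl (OpTyped.var rfl) (OpTyped.gate rfl)
    · refine GateRot.sum fun a ha => ?_
      simp only [List.mem_cons, List.not_mem_nil, or_false] at ha
      rcases ha with rfl | rfl <;> exact OpTyped.gate rfl
  · cases h with
    | mul hπ hu hu' => cases hu with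
      | var h => exact absurd h (by simp [Shape.sub])

/-- Typing of a prefix and of the last gate. [cite: LagardeLimayeSrinivasan2018, §4] -/
theorem rot_snoc {T : Shape} {ty : ℕ → List Bool} {gs : List (Gate R σ)} {g : Gate R σ}
    (hg : ∀ k (hk : k < (gs ++ [g]).length), GateRot T ty (ty k) (gs ++ [g])[k]) :
    (∀ k (hk : k < gs.length), GateRot T ty (ty k) gs[k]) ∧ GateRot T ty (ty gs.length) g :=
  ⟨fun k hk => by
    have h := hg k (by rw [List.length_append, List.length_singleton]; omega)
    rwa [List.getElem_append_left hk] at h,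
   by simpa using hg gs.length (by simp)⟩

/-- [cite: LagardeLimayeSrinivasan2018, §4 Theorem 17] -/
theorem gateRot_hom {T : Shape} {ty : ℕ → List Bool} {π : List Bool} {g : Gate R σ}
    (hg : GateRot T ty π g) (vals : List (FreeAlgebra R σ))
    (hvals : ∀ j, j < vals.length →
      (T.sub (ty j) = none → vals.getD j 0 = 0) ∧
      (∀ S, T.sub (ty j) = some S → degPart T.size S.size (vals.getD j 0) = vals.getD j 0)) :
    (T.sub π = none → g.ncEval vals = 0) ∧
    (∀ S, T.sub π = some S → degPart T.size S.size (g.ncEval vals) = g.ncEval vals) := by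
  cases hg with
  | sum h => exact gateTyped_hom (GateTyped.sum h) vals hvals
  | copy h => exact gateTyped_hom (GateTyped.copy h) vals hvals
  | mul hπ hu hu' => exact gateTyped_hom (GateTyped.mul hπ hu hu') vals hvals
  | @rot u u' l r hπ hu hu' =>
    rw [show Gate.ncEval vals (Gate.prod [u, u']) = u.ncEval vals * u'.ncEval vals by
      simp [Gate.ncEval]]
    refine ⟨fun hn => (by rw [hπ] at hn; cases hn), fun S hS => ?_⟩
    rw [hπ, Option.some.injEq] at hS; subst hS
    have hle := Shape.off_add_size_le hπ
    have hr := (opTyped_hom hu vals hvals).2 r (by simp only [Shape.sub_sub hπ, Shape.sub])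
    have hl := (opTyped_hom hu' vals hvals).2 l (by simp only [Shape.sub_sub hπ, Shape.sub])
    simp only [Shape.size] at hle ⊢; rw [Nat.add_comm l.size r.size]
    exact degPart_mul_of_eq hr hl (by omega)

/-- **Homogeneity**: gate `j` computes `0` if `ty j` is not a node of `T`, else a homogeneous
polynomial of degree `|T_{ty j}|`. [cite: LagardeLimayeSrinivasan2018, §4 Theorem 17] -/
theorem rot_typed_hom {T : Shape} {ty : ℕ → List Bool} (gs : List (Gate R σ))
    (hg : ∀ k (hk : k < gs.length), GateRot T ty (ty k) gs[k]) :
    ∀ j, j < gs.length →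
      (T.sub (ty j) = none → (ncGateValues gs).getD j 0 = 0) ∧
      (∀ S, T.sub (ty j) = some S →
        degPart T.size S.size ((ncGateValues gs).getD j 0) = (ncGateValues gs).getD j 0) := by
  induction gs using List.reverseRecOn with
  | nil => intro j hj; exact absurd hj (Nat.not_lt_zero j)
  | append_singleton gs g ih =>
    obtain ⟨hg', hlast⟩ := rot_snoc hg
    have hlen : (ncGateValues gs).length = gs.length := by
      simpa using (ncGateValues_append_getD gs []).1
    intro j hj
    rw [List.length_append, List.length_singleton] at hj
    rcases Nat.lt_or_ge j gs.length with hj' | hj'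
    · rw [(ncGateValues_append_getD gs [g]).2 j hj']
      exact ih hg' j hj'
    · obtain rfl : j = gs.length := by omega
      rw [ncGateValues_getD_length]
      exact gateRot_hom hlast (ncGateValues gs) fun i hi => ih hg' i (by omega)

/-- The ROTATION SPAN over a frame set `F`: the `R`-span of the framed bodies `h · g · h̄`,
`g ∈ B`, `(deg h, deg h̄) ∈ F` (read by `degPart d`). [cite: LagardeLimayeSrinivasan2018, §4] -/
def rotSpan (B : Set (FreeAlgebra R σ)) (d : ℕ) (F : Finset (ℕ × ℕ)) :
    Submodule R (FreeAlgebra R σ) :=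
  Submodule.span R {x | ∃ p ∈ F, ∃ g h hb : FreeAlgebra R σ, g ∈ B ∧ degPart d p.1 h = h ∧
    degPart d p.2 hb = hb ∧ x = h * g * hb}

/-- [cite: LagardeLimayeSrinivasan2018, §4 Theorem 17] -/
theorem rotSpan_mono (B : Set (FreeAlgebra R σ)) (d : ℕ) {F G : Finset (ℕ × ℕ)} (h : F ⊆ G) :
    rotSpan B d F ≤ rotSpan B d G :=
  Submodule.span_mono fun _ ⟨p, hp, g, h', hb, hg, hh, hhb, hx⟩ =>
    ⟨p, h hp, g, h', hb, hg, hh, hhb, hx⟩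

/-- The UPT span is the one-frame case. [cite: LagardeLimayeSrinivasan2018, §4 Theorem 17] -/
theorem uptSpan_le_rotSpan (B : Set (FreeAlgebra R σ)) (d : ℕ) {F : Finset (ℕ × ℕ)} {a b : ℕ}
    (h : (a, b) ∈ F) : uptSpan B d a b ≤ rotSpan B d F :=
  Submodule.span_mono fun _ ⟨g, h', hb, hg, hh, hhb, hx⟩ => ⟨(a, b), h, g, h', hb, hg, hh, hhb, hx⟩

/-- Right factors shift right contexts. [cite: LagardeLimayeSrinivasan2018, §4 Theorem 17] -/
theorem mul_mem_rotSpan {B : Set (FreeAlgebra R σ)} {d c : ℕ} {F : Finset (ℕ × ℕ)}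
    {x q : FreeAlgebra R σ} (hx : x ∈ rotSpan B d F) (hq : degPart d c q = q)
    (hF : ∀ p ∈ F, p.2 + c ≤ d) :
    x * q ∈ rotSpan B d (F.image fun p => (p.1, p.2 + c)) := by
  unfold rotSpan at hx
  induction hx using Submodule.span_induction with
  | mem x hx' =>
    obtain ⟨p, hp, g, h, hb, hg, hh, hhb, rfl⟩ := hx'
    exact Submodule.subset_span ⟨(p.1, p.2 + c), Finset.mem_image_of_mem _ hp, g, h, hb * q,
      hg, hh, degPart_mul_of_eq hhb hq (hF p hp), by simp only [mul_assoc]⟩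
  | zero => rw [zero_mul]; exact zero_mem _
  | add x y _ _ hx hy => rw [add_mul]; exact add_mem hx hy
  | smul t x _ hx => rw [smul_mul_assoc]; exact Submodule.smul_mem _ t hx

/-- Left factors shift left contexts. [cite: LagardeLimayeSrinivasan2018, §4 Theorem 17] -/
theorem mem_rotSpan_mul {B : Set (FreeAlgebra R σ)} {d c : ℕ} {F : Finset (ℕ × ℕ)}
    {x q : FreeAlgebra R σ} (hx : x ∈ rotSpan B d F) (hq : degPart d c q = q)
    (hF : ∀ p ∈ F, c + p.1 ≤ d) :
    q * x ∈ rotSpan B d (F.image fun p => (p.1 + c, p.2)) := by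
  unfold rotSpan at hx
  induction hx using Submodule.span_induction with
  | mem x hx' =>
    obtain ⟨p, hp, g, h, hb, hg, hh, hhb, rfl⟩ := hx'
    refine Submodule.subset_span ⟨(p.1 + c, p.2), Finset.mem_image_of_mem _ hp, g, q * h, hb,
      hg, ?_, hhb, by simp only [mul_assoc]⟩
    show degPart d (p.1 + c) (q * h) = q * h
    rw [Nat.add_comm p.1 c]
    exact degPart_mul_of_eq hq hh (hF p hp)
  | zero => rw [mul_zero]; exact zero_mem _
  | add x y _ _ hx hy => rw [mul_add]; exact add_mem hx hy
  | smul t x _ hx => rw [mul_smul_comm]; exact Submodule.smul_mem _ t hx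

/-- Operand step. [cite: LagardeLimayeSrinivasan2018, §4 Theorem 17] -/
theorem opRot_span {T : Shape} {ty : ℕ → List Bool} {π₀ : List Bool} {S₀ : Shape}
    (hS₀ : T.sub π₀ = some S₀) (h2 : 2 ≤ S₀.size) (B : Set (FreeAlgebra R σ))
    (vals : List (FreeAlgebra R σ))
    (hW : ∀ j, j < vals.length → ∀ (τ : List Bool) (S : Shape), π₀ = ty j ++ τ →
      T.sub (ty j) = some S → vals.getD j 0 ∈ rotSpan B T.size (frames S τ))
    {π : List Bool} {u : Operand R σ} (hu : OpTyped T ty π u) (τ : List Bool) (S : Shape)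
    (hπ : π₀ = π ++ τ) (hS : T.sub π = some S) :
    u.ncEval vals ∈ rotSpan B T.size (frames S τ) := by
  cases hu with
  | @gate j h =>
    subst h
    by_cases hj : j < vals.length
    · exact hW j hj τ S hπ hS
    · rw [ncEval_gate, List.getD_eq_default _ _ (Nat.le_of_not_lt hj)]; exact zero_mem _
  | @var x h =>
    have h' := Shape.sub_sub h τ; rw [← hπ, hS₀] at h'
    cases τ with
    | nil => rw [Shape.sub_nil, Option.some.injEq] at h'; subst h'; revert h2; simp [Shape.size]
    | cons c τ => exact absurd h' (by simp [Shape.sub])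
  | zero =>
    rw [show (Operand.const (0 : R) : Operand R σ).ncEval vals = 0 from map_zero (algebraMap R _)]
    exact zero_mem _

/-- Gate step (new: the rotated product). [cite: LagardeLimayeSrinivasan2018, §4 Theorem 17] -/
theorem gateRot_span {T : Shape} {ty : ℕ → List Bool} {π₀ : List Bool} {S₀ : Shape}
    (hS₀ : T.sub π₀ = some S₀) (h2 : 2 ≤ S₀.size) (B : Set (FreeAlgebra R σ))
    (vals : List (FreeAlgebra R σ))
    (hH : ∀ j, j < vals.length →
      (T.sub (ty j) = none → vals.getD j 0 = 0) ∧
      (∀ S, T.sub (ty j) = some S → degPart T.size S.size (vals.getD j 0) = vals.getD j 0))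
    (hW : ∀ j, j < vals.length → ∀ (τ : List Bool) (S : Shape), π₀ = ty j ++ τ →
      T.sub (ty j) = some S → vals.getD j 0 ∈ rotSpan B T.size (frames S τ))
    {π : List Bool} {g : Gate R σ} (hg : GateRot T ty π g) (hself : π = π₀ → g.ncEval vals ∈ B)
    (τ : List Bool) (S : Shape) (hπ : π₀ = π ++ τ) (hS : T.sub π = some S) :
    g.ncEval vals ∈ rotSpan B T.size (frames S τ) := by
  cases τ with
  | nil =>
    rw [List.append_nil] at hπ; subst hπ
    rw [frames_nil]
    exact Submodule.subset_span ⟨(0, 0), Finset.mem_singleton_self _, _, 1, 1, hself rfl,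
      degPart_zero_one _, degPart_zero_one _, by rw [one_mul, mul_one]⟩
  | cons c τ =>
    cases hg with
    | @sum args h =>
      rw [show Gate.ncEval vals (Gate.sum args) = (args.map fun ca => ca.1 • ca.2.ncEval vals).sum
        from rfl]
      refine list_sum_mem fun x hx => ?_
      obtain ⟨⟨c', o⟩, ho, rfl⟩ := List.mem_map.1 hx
      exact Submodule.smul_mem _ c'
        (opRot_span hS₀ h2 B vals hW (u := o) (h (c', o) ho) (c :: τ) S hπ hS)
    | @copy u h =>
      rw [show Gate.ncEval vals (Gate.prod [u]) = u.ncEval vals by simp [Gate.ncEval]]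
      exact opRot_span hS₀ h2 B vals hW h (c :: τ) S hπ hS
    | @mul u u' l r hπ' hu hu' =>
      rw [show Gate.ncEval vals (Gate.prod [u, u']) = u.ncEval vals * u'.ncEval vals by
        simp [Gate.ncEval]]
      rw [hπ', Option.some.injEq] at hS; subst hS
      have hl : T.sub (π ++ [false]) = some l := by simp only [Shape.sub_sub hπ', Shape.sub]
      have hr : T.sub (π ++ [true]) = some r := by simp only [Shape.sub_sub hπ', Shape.sub]
      have hle := Shape.off_add_size_le hπ'; simp only [Shape.size] at hle
      cases c with
      | false =>
        have hπ2 : π₀ = π ++ [false] ++ τ := by rw [hπ, List.append_assoc, List.singleton_append]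
        have hl0 : l.sub τ = some S₀ := by rw [← Shape.sub_sub hl, ← hπ2, hS₀]
        simp only [frames]
        exact rotSpan_mono B T.size Finset.subset_union_left (mul_mem_rotSpan
          (opRot_span hS₀ h2 B vals hW hu τ l hπ2 hl) ((opTyped_hom hu' vals hH).2 r hr)
          fun p hp => by have h := frames_total hl0 hp; omega)
      | true =>
        have hπ2 : π₀ = π ++ [true] ++ τ := by rw [hπ, List.append_assoc, List.singleton_append]
        have hr0 : r.sub τ = some S₀ := by rw [← Shape.sub_sub hr, ← hπ2, hS₀]
        simp only [frames]
        exact rotSpan_mono B T.size Finset.subset_union_left (mem_rotSpan_mul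
          (opRot_span hS₀ h2 B vals hW hu' τ r hπ2 hr) ((opTyped_hom hu vals hH).2 l hl)
          fun p hp => by have h := frames_total hr0 hp; omega)
    | @rot u u' l r hπ' hu hu' =>
      rw [show Gate.ncEval vals (Gate.prod [u, u']) = u.ncEval vals * u'.ncEval vals by
        simp [Gate.ncEval]]
      rw [hπ', Option.some.injEq] at hS; subst hS
      have hl : T.sub (π ++ [false]) = some l := by simp only [Shape.sub_sub hπ', Shape.sub]
      have hr : T.sub (π ++ [true]) = some r := by simp only [Shape.sub_sub hπ', Shape.sub]
      have hle := Shape.off_add_size_le hπ'; simp only [Shape.size] at hle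
      cases c with
      | false =>
        have hπ2 : π₀ = π ++ [false] ++ τ := by rw [hπ, List.append_assoc, List.singleton_append]
        have hl0 : l.sub τ = some S₀ := by rw [← Shape.sub_sub hl, ← hπ2, hS₀]
        simp only [frames]
        exact rotSpan_mono B T.size Finset.subset_union_right (mem_rotSpan_mul
          (opRot_span hS₀ h2 B vals hW hu' τ l hπ2 hl) ((opTyped_hom hu vals hH).2 r hr)
          fun p hp => by have h := frames_total hl0 hp; omega)
      | true =>
        have hπ2 : π₀ = π ++ [true] ++ τ := by rw [hπ, List.append_assoc, List.singleton_append]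
        have hr0 : r.sub τ = some S₀ := by rw [← Shape.sub_sub hr, ← hπ2, hS₀]
        simp only [frames]
        exact rotSpan_mono B T.size Finset.subset_union_right (mul_mem_rotSpan
          (opRot_span hS₀ h2 B vals hW hu τ r hπ2 hr) ((opTyped_hom hu' vals hH).2 l hl)
          fun p hp => by have h := frames_total hr0 hp; omega)

/-- **Structure theorem**: for a node `π₀` with ≥ 2 leaves, a gate typed by a prefix `π` of
`π₀ = π ++ τ` has value in `rotSpan _ |T| (frames T_π τ)`. [cite: LagardeLimayeSrinivasan2018] -/
theorem rot_typed_span {T : Shape} {ty : ℕ → List Bool} {π₀ : List Bool} {S₀ : Shape}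
    (hS₀ : T.sub π₀ = some S₀) (h2 : 2 ≤ S₀.size) (gs : List (Gate R σ))
    (hg : ∀ k (hk : k < gs.length), GateRot T ty (ty k) gs[k]) :
    ∀ j, j < gs.length → ∀ (τ : List Bool) (S : Shape), π₀ = ty j ++ τ → T.sub (ty j) = some S →
      (ncGateValues gs).getD j 0 ∈ rotSpan (tyBodies gs ty π₀) T.size (frames S τ) := by
  induction gs using List.reverseRecOn with
  | nil => intro j hj; exact absurd hj (Nat.not_lt_zero j)
  | append_singleton gs g ih =>
    obtain ⟨hg', hlast⟩ := rot_snoc hg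
    have hlen : (ncGateValues gs).length = gs.length := by
      simpa using (ncGateValues_append_getD gs []).1
    have hmono : ∀ F, rotSpan (tyBodies gs ty π₀) T.size F ≤
        rotSpan (tyBodies (gs ++ [g]) ty π₀) T.size F := fun F =>
      Submodule.span_mono fun _ ⟨p, hp, x, h, hb, ⟨i, hi, hty, hx'⟩, hh, hhb, hx⟩ =>
        ⟨p, hp, x, h, hb, ⟨i, by rw [List.length_append, List.length_singleton]; omega, hty,
          by rw [hx', (ncGateValues_append_getD gs [g]).2 i hi]⟩, hh, hhb, hx⟩
    intro j hj τ S hπ hS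
    rw [List.length_append, List.length_singleton] at hj
    rcases Nat.lt_or_ge j gs.length with hj' | hj'
    · rw [(ncGateValues_append_getD gs [g]).2 j hj']
      exact hmono _ (ih hg' j hj' τ S hπ hS)
    · obtain rfl : j = gs.length := by omega
      rw [ncGateValues_getD_length]
      exact gateRot_span hS₀ h2 (tyBodies (gs ++ [g]) ty π₀) (ncGateValues gs)
        (fun i hi => rot_typed_hom gs hg' i (by omega))
        (fun i hi τ' S' hπ' hS' => hmono _ (ih hg' i (by omega) τ' S' hπ' hS')) hlast
        (fun hty => ⟨gs.length, by rw [List.length_append, List.length_singleton]; omega, hty,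
          (ncGateValues_getD_length gs g).symm⟩) τ S hπ hS

/-- **ROTATION-UPT STRUCTURE THEOREM at the output.** MODEL: rotUPT = rotation-UPT NORMAL FORM:
circuits typed by a shape T in which every product gate multiplies an operand typed by its left
child and one typed by its right child IN EITHER ORDER (GateRot = LLS18 Prop 7 typing + the
rotated product); the conversion of an arbitrary rotUPT circuit (LLS18 §4: all parse trees
rotations of one tree) to this normal form (gate duplication per node, poly blow-up) is NOT
formalised. For every node `π₀` of `T` with ≥ 2 leaves, the output of a rot-typed circuit of
shape `T` is an `R`-combination of `h · g · h̄`, `g` a value of a gate typed `π₀`,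
`(deg h, deg h̄) ∈ frames T π₀`; says nothing about untyped circuits (`PerNotNcVP` stays open).
[cite: LagardeLimayeSrinivasan2018, §4 Theorem 17] -/
theorem output_mem_rotSpan (P : ArithCircuit R σ) {T : Shape} {ty : ℕ → List Bool}
    (hg : ∀ k (hk : k < P.gates.length), GateRot T ty (ty k) P.gates[k])
    (ho : OpTyped T ty [] P.output) {π₀ : List Bool} {S₀ : Shape} (hS₀ : T.sub π₀ = some S₀)
    (h2 : 2 ≤ S₀.size) :
    P.ncEval ∈ rotSpan (tyBodies P.gates ty π₀) T.size (frames T π₀) := by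
  have hlen : (ncGateValues P.gates).length = P.gates.length := by
    simpa using (ncGateValues_append_getD P.gates []).1
  exact opRot_span hS₀ h2 (tyBodies P.gates ty π₀) (ncGateValues P.gates)
    (fun j hj τ S hπ hS => rot_typed_span hS₀ h2 P.gates hg j (by omega) τ S hπ hS) ho π₀ T
    (List.nil_append π₀).symm (Shape.sub_nil T)

end Typed

end Summit.ValiantsHypothesis.ValiantsHypothesis.Theorems.NcRotParseTree

end
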